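import Mathlib
import Summits.RiemannHypothesis.RiemannHypothesis.Theorems.SignConeConeMagnificationDesignDeficit

/-!
# Crux `SignCone.ConeMagnification` (stmt-RiemannHypothesis-16303), line `Sketch` r8:
# transfer glue — the deficit hypothesis of `stub_transfer` directly from the type inequalities

Seat-0 programme, optional shortcut for the composition `ConeMagnification_of`: the prime deficit at the scale
`1/2` (`Design.summable_deficit_sqrt`, from `c ≥ 0`, Loc and TI alone) dominates the deficit at every scale
`σ > 1/2` (`p^σ ≥ √p`), which is exactly the hypothesis `hdef` of the landed Landau transfer `stub_transfer`.
So the composition may go `… → stub_combLocal → stub_combType → deficit_rpow_of_typeIneq → stub_transfer`,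
bypassing AX-A/AX-B/AX-C and the finite spine `stub_deficitOfDesign` (both routes are in the tree).
-/

noncomputable section

-- `Summit.RiemannHypothesis.RiemannHypothesis.…` repeats a namespace component by design (D-0017 layout).
set_option linter.dupNamespace false

open Finset Filter
open scoped BigOperators ComplexConjugate Topology

namespace Summit.RiemannHypothesis.RiemannHypothesis.Theorems.SignConeConeMagnification

namespace Design

/-- **The deficit at every scale `σ > 1/2` from the type inequalities** (seat-0): under `c ≥ 0`, Loc and TI,
`Σ_p (log p − c(p))₊ p^{-σ} < ∞` for every `σ > 1/2` — the hypothesis `hdef` of `stub_transfer`. [folklore] -/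
theorem deficit_rpow_of_typeIneq (c : ℕ → ℝ) (hc0 : ∀ n, 0 ≤ c n)
    (hLoc : ∀ p : ℕ, p.Prime → Summable (fun n : ℕ => if p ∣ n then c n / n else 0))
    (hTI : ∀ α : ℕ → ℂ, ∀ L : ℕ, (∀ m, L < m → α m = 0) →
      ∃ T : ℝ, Tendsto (fun x : ℝ => ∑ n ∈ Finset.Icc 1 ⌊x⌋₊,
          (c n - ArithmeticFunction.vonMangoldt n) / n *
            (∑ ℓ ∈ Finset.Icc 1 L, ∑ ℓ' ∈ Finset.Icc 1 L, α ℓ * (starRingEnd ℂ) (α ℓ') *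
            (((Nat.gcd (n * ℓ') ℓ : ℕ) : ℝ) : ℂ) / (Real.sqrt ((ℓ : ℝ) * ℓ') : ℂ)).re) atTop (𝓝 T) ∧
        T ≤ 1 / 2 * (∑ ℓ ∈ Finset.Icc 1 L, ∑ ℓ' ∈ Finset.Icc 1 L, α ℓ * (starRingEnd ℂ) (α ℓ') *
            (((Nat.gcd (1 * ℓ') ℓ : ℕ) : ℝ) : ℂ) / (Real.sqrt ((ℓ : ℝ) * ℓ') : ℂ)).re) :
    ∀ σ : ℝ, 1 / 2 < σ →
      Summable (fun p : ℕ => if p.Prime then max (Real.log p - c p) 0 / (p : ℝ) ^ σ else 0) := by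
  intro σ hσ
  have hdef := summable_deficit_sqrt c hc0 hLoc hTI
  refine Summable.of_nonneg_of_le (fun p => ?_) (fun p => ?_) hdef
  · split_ifs
    · exact div_nonneg (le_max_right _ _) (Real.rpow_nonneg (Nat.cast_nonneg p) σ)
    · exact le_rfl
  · by_cases hp : p.Prime
    · rw [if_pos hp, if_pos hp]
      have hp1 : (1 : ℝ) ≤ (p : ℝ) := by exact_mod_cast hp.one_lt.le
      have hs : Real.sqrt p ≤ (p : ℝ) ^ σ := by
        rw [Real.sqrt_eq_rpow]
        exact Real.rpow_le_rpow_of_exponent_le hp1 hσ.le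
      exact div_le_div_of_nonneg_left (le_max_right _ _) (Real.sqrt_pos.2 (by linarith)) hs
    · rw [if_neg hp, if_neg hp]

/-- **Registered sub-goal `designTransferGlue`** (seat-0 anchor of this file): `c ≥ 0`, Loc and TI give the deficit
hypothesis of `stub_transfer` at every `σ > 1/2`. [folklore] -/
theorem designTransferGlue : ∀ c : ℕ → ℝ, (∀ n, 0 ≤ c n) →
    (∀ p : ℕ, p.Prime → Summable (fun n : ℕ => if p ∣ n then c n / n else 0)) →
    (∀ α : ℕ → ℂ, ∀ L : ℕ, (∀ m, L < m → α m = 0) →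
      ∃ T : ℝ, Filter.Tendsto (fun x : ℝ => ∑ n ∈ Finset.Icc 1 ⌊x⌋₊,
          (c n - ArithmeticFunction.vonMangoldt n) / n *
            (∑ ℓ ∈ Finset.Icc 1 L, ∑ ℓ' ∈ Finset.Icc 1 L, α ℓ * (starRingEnd ℂ) (α ℓ') *
            (((Nat.gcd (n * ℓ') ℓ : ℕ) : ℝ) : ℂ) / (Real.sqrt ((ℓ : ℝ) * ℓ') : ℂ)).re) Filter.atTop (nhds T) ∧
        T ≤ 1 / 2 * (∑ ℓ ∈ Finset.Icc 1 L, ∑ ℓ' ∈ Finset.Icc 1 L, α ℓ * (starRingEnd ℂ) (α ℓ') *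
            (((Nat.gcd (1 * ℓ') ℓ : ℕ) : ℝ) : ℂ) / (Real.sqrt ((ℓ : ℝ) * ℓ') : ℂ)).re) →
    ∀ σ : ℝ, 1 / 2 < σ →
      Summable (fun p : ℕ => if p.Prime then max (Real.log p - c p) 0 / (p : ℝ) ^ σ else 0) :=
  fun c hc0 hLoc hTI => deficit_rpow_of_typeIneq c hc0 hLoc hTI

end Design

end Summit.RiemannHypothesis.RiemannHypothesis.Theorems.SignConeConeMagnification
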